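import Literature.MathematicalPhysics.QuantumFieldTheory.Balaban1983to89.B16NodeKnitRepTowerLF
import Literature.MathematicalPhysics.QuantumFieldTheory.Balaban1983to89.T4DatumAssemblyTower
import Literature.MathematicalPhysics.QuantumFieldTheory.Balaban1983to89.Node00.LargeFieldReprOfRecord

/-!
# `Balaban1983to89.B16NodeKnitTowerDatum` — YM-DAG node N13 · [Balaban1989LargeFieldII] CMP **122** (1989) 355–392, Theorem 1 p. 355 + (0.1), Cor. 3
# pp. 387 ∕ 391: the N13 knit AT A TOWER DATUM `T4DatumAssembly.datumOfTower F N M τ` — the Stage-₉ datum SHAPE of record (machine core + EXPLICIT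
# density tower along the averaging of record) — over a represented tower, in the tree's §2 currency, and over the SLOT FAMILY of the (2.18)
# representation of record (`Node00.TexpAOfRecord`, `densityOfRepr`); N13's Cor.-3 conclusion UNFOLDED AT THE CORE'S OBJECTS

statement-level bookkeeping over published theorems with citation tags; kernel-checked compositions of tree theorems;
nothing here is a claim about the Yang–Mills mass gap.

CITATION HEADER (lean-in-tree rule).  Source: T. Bałaban, *Large field renormalization. II. Localization, exponentiation, and bounds for the
𝐑 operation*, Commun. Math. Phys. **122**, 355–392 (1989), doi:10.1007/bf01238433 [Balaban1989LargeFieldII] (cell paper B16 = «[V]»), with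
[Balaban1988Convergent] («[III]» CMP 119: the assumed 𝐑 of p. 244, the representation (2.18) p. 257, Thm 1 p. 262, Cor. 3 (2.50) p. 264, the step (3.1)
p. 264 and (3.24)–(3.25) p. 270) and [Balaban1989LargeFieldI] («[IV]» CMP 122: (0.2)–(0.4) p. 176).  Seat `pub-ymgap-dag-n13-a` (YM-PLAN Track A, HUMAN
RULING D-0062: the KNIT-BY-NAME seat of node N13; chair R420 ∕ R422 ∕ R424 ∕ R434 ∕ R437 ∕ R439), module 12 of the seat.  BY NAME and UNCHANGED:
`…T4DatumAssemblyTower` (seat dag-n23-a: `RGMachineCore`, `RGMachineCore.Tower`, `RGMachineCore.construction`, `datumOfTower`, `datumOfTower_C`),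
`…B16NodeKnitRepTower` (module 8: `rOperation_of_repTower`), `…B16NodeKnitRecord5` (module 5: `b16_main_of_rOperation_of_uvSlot`), `…Node00.LargeFieldReprOfRecord`
(seat node00-def-R: `SeqOfRecord`, `chiSeqOfRecord`, `TexpAOfRecord`, `densityOfRepr`), the pre-cell module `…Step` (`LFTower`, `LFConsts`, `LFHyp`, `LFHypImproved`,
`LFNewTerms`), `…B16` (`UVIneq`, `uvIneq_of_le`), `…B14Cor3` (`inInterval_of_le`), `…DagBinding` (`leavesP`, `WorldP`), `…Dag` (`B16_main` :253).  The sibling N11 knit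
at the tower datum is seat dag-n11-a's `…B14NodeKnitTowerDatum` (same letters `hC`, `hsucc`, `hρ`, `hS9`); the N11 ∧ N13 junction there BY NAME, the run's (B) and
the pin `B16.EndStatementBPrinted (datumOfTower F N M τ).C` are this seat's module 12b `…B16NodeKnitTowerDatumJunction` (imports both).

WHY THIS FILE (pub-ymgap chair R437 ∕ R439; seat node00-def `STAGE6-9-DESIGN-g28.md`; seat dag-n23-a `T4DatumAssemblyTower`; seats node00-def-T
`TStepOfRecord` ∕ `RepTowerOfRecord` (FILE 1 landed ∕ FILE 2 INTENT) and node00-def-R `RStepSlotOfRecord`; seat dag-n11-a `B14NodeKnitTowerDatum` + its Record9 recipe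
`N11-PIN-LIST.md` v5 §8; this seat's modules 8 ∕ 10 and probe `VOfTower`).  NODE 00's Stage-₉ datum of record is to be `datumOfTower F N M τ` at the machine
CORE of record `M` and the REPRESENTED density tower of record `τ` (`τ.ρ p k := densityOfRepr … texpA p g k`, the density ASSEMBLED from the slot family of
the (2.18) representation, built by `texpA p g (k+1) = Rstep (Tstep (texpA p g k))`).  At a world bound to such a datum (`w.C = (datumOfTower F N M τ).C`)
N13's CONCLUSION `uvBounds` — (0.1) ∕ (2.50) [III] — IS the two-sided bound ON THE TOWER'S EXPLICIT FUNCTIONS `τ.ρ P k`, at the core's characteristic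
functions `M.χ`, background Wilson actions `M.wilsonBG`, the forward-generated couplings `genSeq M.βfun P.g0 k` and the site count of `T₁^{(k)}`
(`uvBounds_iff_tower`, `rfl`), hence — with `τ.ρ P k = eval rep_k` — a bound on the REPRESENTED FUNCTION `eval rep_k` POINTWISE (`uvBounds_iff_eval`): the
(0.1) face print states (p. 356 *«with the constants E₋, E₊ independent of k, T_η, U_k»*; p. 387 *«This implies the inequality (2.50) [III], hence Corollary
3.»*), no Radon–Nikodym version in sight.  And N13's 𝐑-PRODUCT — [III] p. 244's assumed property of 𝐑, what [V] Thm 1 proves (pp. 356–391 with [IV]) — reads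
at representation level `∀ r, LawsT k r → Laws (k+1) (Rstep k r)` ((R₉), module 8), delivering the world's `rOperation` leaf through the along-the-tower pin of
the 𝐑-carriers (`VOfTower`: `ROpLeaf V ↔ ∀ k < K, LawsT k (Tstep rep_k) → Laws (k+1) rep_{k+1}`, module 8 §2).  This file is the N13 knit at the tower datum —
the sibling of seat dag-n11-a's N11 knit there —, generic over the representation data (§1), in the tree's own §2 currency (§1), over the SLOT FAMILY of record
with `eval := densityOfRepr` (§2), so that NODE 00's `Record9` instantiates it by `rfl` (`hC := datumOfTower_C`-shaped, `hρ := rfl` at node00-def-T's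
`rhoOfRecord9`, `hS9 := Iff.rfl`, `hsucc :=` node00-def-T's `texpAOfRecord_succ`, `hRpin :=` module 8 §2 at the pinned `V`), whatever its final field names.

WHAT THIS FILE PROVES (0 `sorry`, 0 `def`, standard axioms).
§1 `smallCouplings_iff_genFlow` ∕ **`uvBounds_iff_tower`** ∕ `uvBounds_iff_eval` (N13's antecedent and conclusion at a tower-datum world, UNFOLDED at the core's
   objects and the tower's explicit ∕ represented densities; N11's side is seat dag-n11-a's `densitiesDescribed_iff_core`, used inline); `uvSlot_at_datumOfTower` ∕
   `_dominated` (the Cor.-3 slot from (UV₉) stated on `eval rep_k` at the core's objects below a threshold `γ₁ ≥ w.γ`, resp. from DOMINATED per-step constants with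
   `B16.UVIneq ((datumOfTower F N M τ).C P) k U E₋ E₊` pointwise — the Cor.-3 chain's output currency — given `M.χ ≥ 0`); **`b16_main_at_datumOfTower_repTower`**
   (N13 at `(w, P)` from (R₉) + recursion + pin reading + the Stage-₉ reading + (UV₉)); `b16_main_at_datumOfTower_along` ((R₉) asked only along the tower);
   `b16_main_at_datumOfTower_dominated`; locator `uvIneq_eval_of_b16_main_at_datumOfTower` (A4: what N13's Cor.-3 product SAYS there — (0.1) pointwise on `eval
   rep_k`); **`b16_main_at_datumOfTower_lf`** (the same in the tree's §2 currency `Step.LFHyp ∕ LFHypImproved ∕ LFNewTerms`, 𝐑-half of the per-step obligation).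
§2 `uvBounds_iff_densityOfRepr` ∕ **`b16_main_at_datumOfTower_slots`** ∕ `_slots_along` (the same over the SLOT FAMILY `texpA P g` of the (2.18) representation of
   record, `eval := densityOfRepr`, (R₉) ON SLOTS `∀ f, LawsT k f → Laws (k+1) (Rstep k f)`).
§3 `b16_main_forall_towerDatum` (the `S_N13 Rec₉` shape over tower data).

HONEST FRAMING.  A count-neutral SLOT landing (R429 (4)(i)): N13 is NOT discharged — (R₉) = [Balaban1989LargeFieldII] Thm 1 for 𝐑 at representation level and
(UV₉) = (0.1) ∕ Cor. 3 pointwise on the represented densities are displayed HYPOTHESES (what the paper proves, pp. 356–391 and p. 387); the machine core, the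
tower, the representation data, the two steps and the laws are parameters (NODE 00 Stage ₉'s objects: seats node00-def ∕ def-R ∕ def-T); the pin reading
`hRpin` is NODE 00's pin of the world's 𝐑-leaf along the tower; nothing of Bałaban's asserted or proved here.  One finite four-torus programme at fixed `ε`,
Bałaban AS PRINTED with locators; nothing continuum ∕ ℝ⁴ ∕ OS ∕ mass gap ∕ Clay.
-/

noncomputable section

open MeasureTheory
open scoped BigOperators

namespace Literature.MathematicalPhysics.QuantumFieldTheory.Balaban1983to89.B16NodeKnitTowerDatum

open DagBinding T4DatumAssembly T4Continuum Node00 FlowStepRuns Step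
open B16NodeKnitRecord5 (b16_main_of_rOperation_of_uvSlot)
open B16NodeKnitRepTower (rOperation_of_repTower)

variable (F : T4Family) (N : ℕ) [NeZero N]

/-! ## §1. N13 at a tower datum `datumOfTower F N M τ` over a represented tower -/

section TowerDatum

variable (M : RGMachineCore F (SU N)) (τ : M.Tower (avOfRecord F N)) (w : WorldP) (P : B12.RunParams)

/-- At a world bound to a tower datum (`w.C = (datumOfTower F N M τ).C = M.construction τ.ρ`) the interval hypothesis of the run `P` reads the FORWARD-GENERATED
flow `genFlow M.βfun P.g0` on `]0, w.γ]` ((0.18)∕(0.20) from the bare coupling with the core's β-functions; `T4DatumAssembly.flow_datumOfTower`, `rfl`).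
[cite: Balaban1987RG1, (0.17)–(0.20) pp.255–256 (bookkeeping)] -/
theorem smallCouplings_iff_genFlow (hC : w.C = (datumOfTower F N M τ).C) :
    (leavesP w P).smallCouplings ↔ (genFlow M.βfun P.g0).InInterval w.γ P.K := by
  show (w.C P).flow.InInterval w.γ P.K ↔ _
  rw [hC]
  exact Iff.rfl

/-- **N13's CONCLUSION `uvBounds` AT A TOWER-DATUM WORLD, UNFOLDED AT THE CORE'S OBJECTS AND THE TOWER'S EXPLICIT DENSITIES**: for every `k ≤ K` and every
gauge field `U` on `T^{(k)}` of the `K`-th torus, `M.χ P k U · exp[−(1∕g_k²)·M.wilsonBG P k U − w.em(g_k)·|T₁^{(k)}|] ≤ τ.ρ P k U ≤ exp[w.ep(g_k)·|T₁^{(k)}|]` with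
`g_k = genSeq M.βfun P.g0 k` and `|T₁^{(k)}| = Fintype.card (Site (F.P P.K) k)` — (0.1) ∕ (2.50) [III] ON THE FUNCTIONS `τ.ρ P k` (`rfl`: `construction_ρ`,
`construction_g`, the core's `χ`, `wilsonBG`, `numSites`). [cite: Balaban1989LargeFieldII, (0.1) pp.355–356; Balaban1988Convergent, Cor. 3 (2.50) p.264] -/
theorem uvBounds_iff_tower (hC : w.C = (datumOfTower F N M τ).C) :
    (leavesP w P).uvBounds ↔
      ∀ k, k ≤ P.K → ∀ U : GaugeField (F.P P.K) k (SU N),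
        M.χ P k U * Real.exp (-(1 / (genSeq M.βfun P.g0 k) ^ 2 * M.wilsonBG P k U)
            - w.em (genSeq M.βfun P.g0 k) * (Fintype.card (Site (F.P P.K) k) : ℝ)) ≤ τ.ρ P k U ∧
        τ.ρ P k U ≤ Real.exp (w.ep (genSeq M.βfun P.g0 k) * (Fintype.card (Site (F.P P.K) k) : ℝ)) := by
  show (∀ k, k ≤ P.K → ∀ U : (w.C P).Cfg k,
    B16.UVIneq (w.C P) k U (w.em ((w.C P).flow.g k)) (w.ep ((w.C P).flow.g k))) ↔ _
  rw [hC]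
  exact Iff.rfl

variable {Rep : ℕ → Type*} (rep : (k : ℕ) → Rep k) (Tstep : (k : ℕ) → Rep k → Rep (k + 1))
  (Rstep : (k : ℕ) → Rep (k + 1) → Rep (k + 1)) (Laws : (k : ℕ) → Rep k → Prop) (LawsT : (k : ℕ) → Rep (k + 1) → Prop)
  (eval : (k : ℕ) → Rep k → Density (F.P P.K) k (SU N))

/-- **… hence ON THE REPRESENTED FUNCTIONS**: with the tower's densities DEFINED as the represented ones (`τ.ρ P k = eval rep_k`, `hρ` — the Stage-₉ design:
`ρ_k := eval rep_k`, node00-def-T's `rhoOfRecord9`), N13's conclusion at `(w, P)` IS the two-sided bound (0.1) on `eval rep_k`, POINTWISE in the configuration,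
every `k ≤ K` — the face print states (p. 356: constants independent of `k, T_η, U_k`). [cite: Balaban1989LargeFieldII, (0.1) pp.355–356; Balaban1988Convergent, (2.18) p.257] -/
theorem uvBounds_iff_eval (hC : w.C = (datumOfTower F N M τ).C) (hρ : ∀ k, τ.ρ P k = eval k (rep k)) :
    (leavesP w P).uvBounds ↔
      ∀ k, k ≤ P.K → ∀ U : GaugeField (F.P P.K) k (SU N),
        M.χ P k U * Real.exp (-(1 / (genSeq M.βfun P.g0 k) ^ 2 * M.wilsonBG P k U)
            - w.em (genSeq M.βfun P.g0 k) * (Fintype.card (Site (F.P P.K) k) : ℝ)) ≤ eval k (rep k) U ∧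
        eval k (rep k) U ≤ Real.exp (w.ep (genSeq M.βfun P.g0 k) * (Fintype.card (Site (F.P P.K) k) : ℝ)) := by
  rw [uvBounds_iff_tower F N M τ w P hC]
  refine forall₂_congr fun k _ => forall_congr' fun U => ?_
  rw [hρ k]

/-- **N13's Cor.-3 slot AT A TOWER DATUM from (UV₉) at the core's objects.**  If `w.γ ≤ γ₁` and, under the interval hypothesis for the forward-generated flow on
`]0, γ₁]`, every LAW-ABIDING level `k ≤ K` (`Laws k (rep k)`) satisfies (0.1) ON `eval rep_k` pointwise with the world's dependence functions `w.em ∕ w.ep`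
([Balaban1989LargeFieldII] (0.1) pp. 355–356, p. 387 — what [V] proves for Cor. 3), the tower's densities are the represented ones (`hρ`) and the core's clause
YIELDS the laws of the carried representation (`hSL` — the Stage-₉ reading), then «(interval ⇒ §2 description) ⇒ (interval ⇒ `uvBounds`)» holds at `(w, P)`.
(`B14Cor3.inInterval_of_le` for `w.γ ≤ γ₁`.) [cite: Balaban1989LargeFieldII, (0.1) pp.355–356, p.387; Balaban1988Convergent, Cor. 3 (2.50) p.264] -/
theorem uvSlot_at_datumOfTower (hC : w.C = (datumOfTower F N M τ).C) (hρ : ∀ k, τ.ρ P k = eval k (rep k))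
    (hSL : ∀ k, k ≤ P.K → M.Sect2Form P k → Laws k (rep k)) {γ₁ : ℝ} (hγ : w.γ ≤ γ₁)
    (hUV9 : (genFlow M.βfun P.g0).InInterval γ₁ P.K → ∀ k, k ≤ P.K → Laws k (rep k) → ∀ U : GaugeField (F.P P.K) k (SU N),
      M.χ P k U * Real.exp (-(1 / (genSeq M.βfun P.g0 k) ^ 2 * M.wilsonBG P k U)
          - w.em (genSeq M.βfun P.g0 k) * (Fintype.card (Site (F.P P.K) k) : ℝ)) ≤ eval k (rep k) U ∧
      eval k (rep k) U ≤ Real.exp (w.ep (genSeq M.βfun P.g0 k) * (Fintype.card (Site (F.P P.K) k) : ℝ))) :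
    ((leavesP w P).smallCouplings → (leavesP w P).densitiesDescribed) →
      ((leavesP w P).smallCouplings → (leavesP w P).uvBounds) := by
  intro hdd hsc
  have hs : ∀ k, k ≤ P.K → M.Sect2Form P k := by
    have h := hdd hsc
    change ∀ k, k ≤ P.K → (w.C P).Sect2Form k at h
    rw [hC] at h
    exact h
  have hin : (genFlow M.βfun P.g0).InInterval γ₁ P.K :=
    B14Cor3.inInterval_of_le ((smallCouplings_iff_genFlow F N M τ w P hC).1 hsc) hγ
  rw [uvBounds_iff_eval F N M τ w P rep eval hC hρ]
  exact fun k hk U => hUV9 hin k hk (hSL k hk (hs k hk)) U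

/-- **N13's Cor.-3 slot AT A TOWER DATUM from DOMINATED per-step constants** — the currency the cell's Cor.-3 chain delivers (`B16Cor3CurlyGas`: one run, one step, a
`Repr172` representation of the datum's `ρ_k` ⇒ `B16.UVIneq D k U E₋ E₊` pointwise with explicit `E₋, E₊`, here at `D := (datumOfTower F N M τ).C P`): if below the
threshold every law-abiding level admits constants `E₋ ≤ w.em(g_k)`, `E₊ ≤ w.ep(g_k)` with `B16.UVIneq ((datumOfTower F N M τ).C P) k U E₋ E₊` for every `U`, and the
core's characteristic functions are non-negative (`hχ`, the sign convention of (2.17) [III]), the slot follows (`B16.uvIneq_of_le`).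
[cite: Balaban1989LargeFieldII, (0.1) pp.355–356 («E₋, E₊ independent of k, T_η, U_k»), p.387] -/
theorem uvSlot_at_datumOfTower_dominated (hC : w.C = (datumOfTower F N M τ).C)
    (hSL : ∀ k, k ≤ P.K → M.Sect2Form P k → Laws k (rep k)) {γ₁ : ℝ} (hγ : w.γ ≤ γ₁)
    (hχ : ∀ k, k ≤ P.K → ∀ U : GaugeField (F.P P.K) k (SU N), 0 ≤ M.χ P k U)
    (hUVd : (genFlow M.βfun P.g0).InInterval γ₁ P.K → ∀ k, k ≤ P.K → Laws k (rep k) →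
      ∃ Em Ep : ℝ, Em ≤ w.em (genSeq M.βfun P.g0 k) ∧ Ep ≤ w.ep (genSeq M.βfun P.g0 k) ∧
        ∀ U : GaugeField (F.P P.K) k (SU N), B16.UVIneq ((datumOfTower F N M τ).C P) k U Em Ep) :
    ((leavesP w P).smallCouplings → (leavesP w P).densitiesDescribed) →
      ((leavesP w P).smallCouplings → (leavesP w P).uvBounds) := by
  intro hdd hsc
  have hs : ∀ k, k ≤ P.K → M.Sect2Form P k := by
    have h := hdd hsc
    change ∀ k, k ≤ P.K → (w.C P).Sect2Form k at h
    rw [hC] at h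
    exact h
  have hin : (genFlow M.βfun P.g0).InInterval γ₁ P.K :=
    B14Cor3.inInterval_of_le ((smallCouplings_iff_genFlow F N M τ w P hC).1 hsc) hγ
  rw [uvBounds_iff_tower F N M τ w P hC]
  intro k hk U
  obtain ⟨Em, Ep, hm, hp, h⟩ := hUVd hin k hk (hSL k hk (hs k hk))
  exact B16.uvIneq_of_le ((datumOfTower F N M τ).C P) k U (hχ k hk U) (h U) hm hp

/-- **N13 AT A TOWER DATUM OVER A REPRESENTED TOWER** ([Balaban1989LargeFieldII] Thm 1 p. 355 + (0.1), Cor. 3 pp. 387 ∕ 391; NODE 00 Stage ₉ shape, pub-ymgap chair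
R437): representation data `rep k : Rep k` per level with `rep (k+1) = Rstep k (Tstep k (rep k))` (`hsucc` — [III] (0.2) at representation level; node00-def-T's
`texpAOfRecord_succ`), the tower's densities `τ.ρ P k = eval rep_k` (`hρ`), the core's clause read as «form ∧ laws» (`hS9`, seat dag-n11-a's letters verbatim).
`Dag.B16_main (leavesP w P)` from N13's two OWN products: (R₉) `hR9` — the 𝐑-step transports the corresponding space into the index-`(k+1)` laws at representation
level, `k < K` (what [V] Thm 1 proves for 𝐑, pp. 356–391 with [IV]) — read into the world's `rOperation` leaf through the PIN READING `hRpin` (NODE 00's pin of the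
𝐑-carriers along the tower, module 8 §2 `rOpLeaf_iff_lawsAlong`); and (UV₉) `hUV9` — (0.1) pointwise ON `eval rep_k` for law-abiding levels below the threshold
`γ₁ ≥ w.γ` (p. 387).  The nine in-edge antecedents are unused by the knit (consumed INSIDE (R₉)∕(UV₉) in print).  HYPOTHESES displayed; count-neutral.
[cite: Balaban1989LargeFieldII, Thm 1 p.355, (0.1) pp.355–356, p.387, p.391; Balaban1988Convergent, (0.2) and p.244, (2.18) p.257, Cor. 3 p.264] -/
theorem b16_main_at_datumOfTower_repTower (hC : w.C = (datumOfTower F N M τ).C)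
    (hsucc : ∀ k, rep (k + 1) = Rstep k (Tstep k (rep k)))
    (hρ : ∀ k, τ.ρ P k = eval k (rep k))
    (hS9 : ∀ k, k ≤ P.K → (M.Sect2Form P k ↔ (τ.ρ P k = eval k (rep k) ∧ Laws k (rep k))))
    (hRpin : (∀ k, k < P.K → LawsT k (Tstep k (rep k)) → Laws (k + 1) (rep (k + 1))) → (w.up P).rOperation)
    (hR9 : ∀ k, k < P.K → ∀ r : Rep (k + 1), LawsT k r → Laws (k + 1) (Rstep k r)) {γ₁ : ℝ} (hγ : w.γ ≤ γ₁)
    (hUV9 : (genFlow M.βfun P.g0).InInterval γ₁ P.K → ∀ k, k ≤ P.K → Laws k (rep k) → ∀ U : GaugeField (F.P P.K) k (SU N),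
      M.χ P k U * Real.exp (-(1 / (genSeq M.βfun P.g0 k) ^ 2 * M.wilsonBG P k U)
          - w.em (genSeq M.βfun P.g0 k) * (Fintype.card (Site (F.P P.K) k) : ℝ)) ≤ eval k (rep k) U ∧
      eval k (rep k) U ≤ Real.exp (w.ep (genSeq M.βfun P.g0 k) * (Fintype.card (Site (F.P P.K) k) : ℝ))) :
    Dag.B16_main (leavesP w P) :=
  b16_main_of_rOperation_of_uvSlot w P (rOperation_of_repTower w P rep Tstep Rstep Laws LawsT hsucc hRpin hR9)
    (uvSlot_at_datumOfTower F N M τ w P rep Laws eval hC hρ (fun k hk h => ((hS9 k hk).1 h).2) hγ hUV9)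

/-- **N13 AT A TOWER DATUM, (R₉) ASKED ONLY ALONG THE TOWER** (`LawsT k (Tstep k (rep k)) → Laws (k+1) (rep (k+1))`; no `Rstep` named) — the weakest form the pin
reading consumes. [cite: Balaban1989LargeFieldII, Thm 1 p.355, (0.1) pp.355–356, p.387, p.391] -/
theorem b16_main_at_datumOfTower_along (hC : w.C = (datumOfTower F N M τ).C) (hρ : ∀ k, τ.ρ P k = eval k (rep k))
    (hS9 : ∀ k, k ≤ P.K → (M.Sect2Form P k ↔ (τ.ρ P k = eval k (rep k) ∧ Laws k (rep k))))
    (hRpin : (∀ k, k < P.K → LawsT k (Tstep k (rep k)) → Laws (k + 1) (rep (k + 1))) → (w.up P).rOperation)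
    (hRalong : ∀ k, k < P.K → LawsT k (Tstep k (rep k)) → Laws (k + 1) (rep (k + 1))) {γ₁ : ℝ} (hγ : w.γ ≤ γ₁)
    (hUV9 : (genFlow M.βfun P.g0).InInterval γ₁ P.K → ∀ k, k ≤ P.K → Laws k (rep k) → ∀ U : GaugeField (F.P P.K) k (SU N),
      M.χ P k U * Real.exp (-(1 / (genSeq M.βfun P.g0 k) ^ 2 * M.wilsonBG P k U)
          - w.em (genSeq M.βfun P.g0 k) * (Fintype.card (Site (F.P P.K) k) : ℝ)) ≤ eval k (rep k) U ∧
      eval k (rep k) U ≤ Real.exp (w.ep (genSeq M.βfun P.g0 k) * (Fintype.card (Site (F.P P.K) k) : ℝ))) :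
    Dag.B16_main (leavesP w P) :=
  b16_main_of_rOperation_of_uvSlot w P (hRpin hRalong)
    (uvSlot_at_datumOfTower F N M τ w P rep Laws eval hC hρ (fun k hk h => ((hS9 k hk).1 h).2) hγ hUV9)

/-- **N13 AT A TOWER DATUM from (R₉) and DOMINATED per-step (0.1) constants** at the datum's construction, given `M.χ ≥ 0` — the form that consumes the Cor.-3 chain's
one-run-one-step outputs (`B16Cor3CurlyGas` ∕ `B16Cor3ActionBounds` at `D := (datumOfTower F N M τ).C P`). [cite: Balaban1989LargeFieldII, Thm 1 p.355, (0.1) pp.355–356, p.387] -/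
theorem b16_main_at_datumOfTower_dominated (hC : w.C = (datumOfTower F N M τ).C)
    (hsucc : ∀ k, rep (k + 1) = Rstep k (Tstep k (rep k)))
    (hSL : ∀ k, k ≤ P.K → M.Sect2Form P k → Laws k (rep k))
    (hRpin : (∀ k, k < P.K → LawsT k (Tstep k (rep k)) → Laws (k + 1) (rep (k + 1))) → (w.up P).rOperation)
    (hR9 : ∀ k, k < P.K → ∀ r : Rep (k + 1), LawsT k r → Laws (k + 1) (Rstep k r)) {γ₁ : ℝ} (hγ : w.γ ≤ γ₁)
    (hχ : ∀ k, k ≤ P.K → ∀ U : GaugeField (F.P P.K) k (SU N), 0 ≤ M.χ P k U)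
    (hUVd : (genFlow M.βfun P.g0).InInterval γ₁ P.K → ∀ k, k ≤ P.K → Laws k (rep k) →
      ∃ Em Ep : ℝ, Em ≤ w.em (genSeq M.βfun P.g0 k) ∧ Ep ≤ w.ep (genSeq M.βfun P.g0 k) ∧
        ∀ U : GaugeField (F.P P.K) k (SU N), B16.UVIneq ((datumOfTower F N M τ).C P) k U Em Ep) :
    Dag.B16_main (leavesP w P) :=
  b16_main_of_rOperation_of_uvSlot w P (rOperation_of_repTower w P rep Tstep Rstep Laws LawsT hsucc hRpin hR9)
    (uvSlot_at_datumOfTower_dominated F N M τ w P rep Laws hC hSL hγ hχ hUVd)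

/-- **What N13's Cor.-3 product SAYS at a tower datum** (located, for the planner's `stub_N13` text over Stage ₉ and the vacuity audit A4): under the Stage-₉ reading
(`hρ`, `hS9`) N13 at `(w, P)` with its in-edge leaves, the interval hypothesis for the forward-generated flow on `]0, w.γ]` and law-abiding levels `∀ k ≤ K,
Laws k (rep k)` YIELDS the two-sided bound (0.1) POINTWISE ON THE REPRESENTED FUNCTIONS `eval rep_k` at the core's objects, every `k ≤ K`, every configuration.
[cite: Balaban1989LargeFieldII, (0.1) pp.355–356 (bookkeeping); Balaban1988Convergent, (2.18) p.257] -/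
theorem uvIneq_eval_of_b16_main_at_datumOfTower (hC : w.C = (datumOfTower F N M τ).C) (hρ : ∀ k, τ.ρ P k = eval k (rep k))
    (hS9 : ∀ k, k ≤ P.K → (M.Sect2Form P k ↔ (τ.ρ P k = eval k (rep k) ∧ Laws k (rep k))))
    (h : Dag.B16_main (leavesP w P))
    (h5 : (leavesP w P).b5) (h6 : (leavesP w P).b6) (h7 : (leavesP w P).b7) (h9 : (leavesP w P).b9) (h10 : (leavesP w P).b10)
    (h11 : (leavesP w P).b11) (h13 : (leavesP w P).b13) (hrb : (leavesP w P).rBasicStep)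
    (hsf : (leavesP w P).smallCouplings → (leavesP w P).smallFieldInductive)
    (hsc : (genFlow M.βfun P.g0).InInterval w.γ P.K) (hlaws : ∀ k, k ≤ P.K → Laws k (rep k))
    (k : ℕ) (hk : k ≤ P.K) (U : GaugeField (F.P P.K) k (SU N)) :
    M.χ P k U * Real.exp (-(1 / (genSeq M.βfun P.g0 k) ^ 2 * M.wilsonBG P k U)
        - w.em (genSeq M.βfun P.g0 k) * (Fintype.card (Site (F.P P.K) k) : ℝ)) ≤ eval k (rep k) U ∧
      eval k (rep k) U ≤ Real.exp (w.ep (genSeq M.βfun P.g0 k) * (Fintype.card (Site (F.P P.K) k) : ℝ)) := by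
  have hdd : (leavesP w P).smallCouplings → (leavesP w P).densitiesDescribed := by
    intro _
    change ∀ k, k ≤ P.K → (w.C P).Sect2Form k
    rw [hC]
    exact fun k hk => (hS9 k hk).2 ⟨hρ k, hlaws k hk⟩
  have hsc' : (leavesP w P).smallCouplings := (smallCouplings_iff_genFlow F N M τ w P hC).2 hsc
  have huv : (leavesP w P).uvBounds := (h h5 h6 h7 h9 h10 h11 h13 hrb hsf).2 hdd hsc'
  exact (uvBounds_iff_eval F N M τ w P rep eval hC hρ).1 huv k hk U

variable {G : Type*} [GaugeGroup G] {Φ 𝒢 𝔄 : Type*} {Pₛ : Params} (T : LFTower Pₛ G Φ 𝒢 𝔄) (c : LFConsts) (βc : ℝ)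

/-- **N13 AT A TOWER DATUM IN THE TREE'S §2 CURRENCY** ([Balaban1989LargeFieldII] Thm 1 p. 355 + (0.1), Cor. 3 pp. 387 ∕ 391): the core's clause read as `τ.ρ P k =
eval rep_k ∧ (Repr k ∧ Step.LFHyp T c k ∧ Step.LFHypImproved T c βc k)` — the (2.18) form, the cumulative conditions and BOUNDS of §2 [III] and the improved
newest-term bounds (`hS9`, seat dag-n11-a's `b14_main_at_datumOfTower_lf` letters verbatim) —; N13 from (R₉ᴸ) `hR9`, THE 𝐑-HALF OF THE TREE'S PER-STEP OBLIGATION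
(`ReprT k → NewT k → Repr (k+1) ∧ Step.LFNewTerms T c βc k`: what [V] proves — localisation, exponentiation, (1.80), (1.89); [III] p. 279), the pin reading `hRpin`,
and (UV₉ᴸ) `hUV` — (0.1) on `eval rep_k` at the core's objects for represented levels with the §2 bounds, below the threshold. HYPOTHESES displayed; count-neutral.
[cite: Balaban1989LargeFieldII, Thm 1 p.355, (0.1) pp.355–356, (1.80) p.383, (1.89) p.387, p.391; Balaban1988Convergent, pp.258–262, p.279, p.244] -/
theorem b16_main_at_datumOfTower_lf (hC : w.C = (datumOfTower F N M τ).C) (Repr ReprT NewT : ℕ → Prop)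
    (hρ : ∀ k, τ.ρ P k = eval k (rep k))
    (hS9 : ∀ k, k ≤ P.K →
      (M.Sect2Form P k ↔ (τ.ρ P k = eval k (rep k) ∧ (Repr k ∧ LFHyp T c k ∧ LFHypImproved T c βc k))))
    (hRpin : (∀ k, k < P.K → ReprT k → NewT k → Repr (k + 1) ∧ LFNewTerms T c βc k) → (w.up P).rOperation)
    (hR9 : ∀ k, k < P.K → ReprT k → NewT k → Repr (k + 1) ∧ LFNewTerms T c βc k) {γ₁ : ℝ} (hγ : w.γ ≤ γ₁)
    (hUV : (genFlow M.βfun P.g0).InInterval γ₁ P.K → ∀ k, k ≤ P.K → Repr k → LFHyp T c k → LFHypImproved T c βc k →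
      ∀ U : GaugeField (F.P P.K) k (SU N),
        M.χ P k U * Real.exp (-(1 / (genSeq M.βfun P.g0 k) ^ 2 * M.wilsonBG P k U)
            - w.em (genSeq M.βfun P.g0 k) * (Fintype.card (Site (F.P P.K) k) : ℝ)) ≤ eval k (rep k) U ∧
        eval k (rep k) U ≤ Real.exp (w.ep (genSeq M.βfun P.g0 k) * (Fintype.card (Site (F.P P.K) k) : ℝ))) :
    Dag.B16_main (leavesP w P) :=
  b16_main_of_rOperation_of_uvSlot w P (hRpin hR9)
    (uvSlot_at_datumOfTower F N M τ w P rep (fun k _ => Repr k ∧ LFHyp T c k ∧ LFHypImproved T c βc k) eval hC hρ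
      (fun k hk h => ((hS9 k hk).1 h).2) hγ fun hin k hk hl U => hUV hin k hk hl.1 hl.2.1 hl.2.2 U)

end TowerDatum

/-! ## §2. N13 at a tower datum over the SLOT FAMILY of the (2.18) representation of record (`eval := Node00.densityOfRepr`) -/

section Slots

variable (M : RGMachineCore F (SU N)) (τ : M.Tower (avOfRecord F N)) (w : WorldP) (P : B12.RunParams)
variable (ν : Stage7Numerics) (Mx : ℕ) (g : ℕ → ℝ) (texpA : TexpAOfRecord F N ν Mx)
variable
  (Tstep : (k : ℕ) → (SeqOfRecord F ν Mx g P.K k → Density (F.P P.K) k (SU N)) →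
    (SeqOfRecord F ν Mx g P.K (k + 1) → Density (F.P P.K) (k + 1) (SU N)))
  (Rstep : (k : ℕ) → (SeqOfRecord F ν Mx g P.K (k + 1) → Density (F.P P.K) (k + 1) (SU N)) →
    (SeqOfRecord F ν Mx g P.K (k + 1) → Density (F.P P.K) (k + 1) (SU N)))
  (Laws : (k : ℕ) → (SeqOfRecord F ν Mx g P.K k → Density (F.P P.K) k (SU N)) → Prop)
  (LawsT : (k : ℕ) → (SeqOfRecord F ν Mx g P.K (k + 1) → Density (F.P P.K) (k + 1) (SU N)) → Prop)

/-- **N13's conclusion at a tower-datum world OVER THE SLOT FAMILY OF RECORD**: with the tower's densities the ASSEMBLED ones `τ.ρ P k = densityOfRepr … texpA P g k`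
(`hρ`; NODE 00's `Record9`, `rfl`), `uvBounds` at `(w, P)` IS (0.1) ON THE ASSEMBLED DENSITY `V ↦ Σ_s χ_k(s)(V)·(𝐓_k e^{A_k})(s)(V)` of the (2.18) representation,
pointwise. [cite: Balaban1989LargeFieldII, (0.1) pp.355–356; Balaban1988Convergent, (2.18) p.257] -/
theorem uvBounds_iff_densityOfRepr (hC : w.C = (datumOfTower F N M τ).C) (hρ : ∀ k, τ.ρ P k = densityOfRepr F N ν Mx texpA P g k) :
    (leavesP w P).uvBounds ↔
      ∀ k, k ≤ P.K → ∀ U : GaugeField (F.P P.K) k (SU N),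
        M.χ P k U * Real.exp (-(1 / (genSeq M.βfun P.g0 k) ^ 2 * M.wilsonBG P k U)
            - w.em (genSeq M.βfun P.g0 k) * (Fintype.card (Site (F.P P.K) k) : ℝ)) ≤ densityOfRepr F N ν Mx texpA P g k U ∧
        densityOfRepr F N ν Mx texpA P g k U ≤ Real.exp (w.ep (genSeq M.βfun P.g0 k) * (Fintype.card (Site (F.P P.K) k) : ℝ)) :=
  uvBounds_iff_eval F N M τ w P (Rep := fun k => SeqOfRecord F ν Mx g P.K k → Density (F.P P.K) k (SU N)) (texpA P g)
    (fun (j : ℕ) (f : SeqOfRecord F ν Mx g P.K j → Density (F.P P.K) j (SU N)) (V : GaugeField (F.P P.K) j (SU N)) =>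
      ∑ s, chiSeqOfRecord F N ν Mx g P.K j s V * f s V)
    hC hρ

/-- **N13 AT A TOWER DATUM OVER THE SLOT FAMILY OF RECORD** ([Balaban1989LargeFieldII] Thm 1 p. 355 + (0.1), Cor. 3 pp. 387 ∕ 391; NODE 00 Stage ₉: node00-def-R FILE 4 +
node00-def-T's slot recursion): the run's representation data ARE its slots `texpA P g k : s ↦ (𝐓_k e^{A_k})(s)` ((2.18) p. 257 [III]), built by `texpA P g (k+1) =
Rstep k (Tstep k (texpA P g k))` (`hsucc`: the value-level T-step (3.1)∕(3.24) then the R-step [IV] (0.3) ON SLOTS; node00-def-T's `texpAOfRecord_succ`, `rfl`), the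
tower's densities are the assembled ones (`hρ`, `rfl` at NODE 00's `Record9`), the core's clause reads «assembled ∧ laws of the slot» (`hS9`).  N13 at `(w, P)` from
its two products IN SLOT CURRENCY: (R₉) `hR9` — a level-`(k+1)` slot obeying `LawsT k` (a (3.25) T-representation with the pre-𝐑 new terms of [III] p. 279 in their
spaces) is turned by the R-step into a slot obeying `Laws (k+1)` (what [V] Thm 1 proves for 𝐑: localisation §1, exponentiation, the bounds (1.80)∕(1.89)), read into
the world's leaf by the pin reading `hRpin`; (UV₉) `hUV9` — (0.1) pointwise on the assembled density of law-abiding slots below the threshold (p. 387).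
[cite: Balaban1989LargeFieldII, Thm 1 p.355, (0.1) pp.355–356, p.387, p.391; Balaban1988Convergent, (2.18) p.257, (3.24)–(3.25) p.270, p.244; Balaban1989LargeFieldI, (0.3) p.176] -/
theorem b16_main_at_datumOfTower_slots (hC : w.C = (datumOfTower F N M τ).C)
    (hsucc : ∀ k, texpA P g (k + 1) = Rstep k (Tstep k (texpA P g k)))
    (hρ : ∀ k, τ.ρ P k = densityOfRepr F N ν Mx texpA P g k)
    (hS9 : ∀ k, k ≤ P.K → (M.Sect2Form P k ↔ (τ.ρ P k = densityOfRepr F N ν Mx texpA P g k ∧ Laws k (texpA P g k))))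
    (hRpin : (∀ k, k < P.K → LawsT k (Tstep k (texpA P g k)) → Laws (k + 1) (texpA P g (k + 1))) → (w.up P).rOperation)
    (hR9 : ∀ k, k < P.K →
      ∀ f : SeqOfRecord F ν Mx g P.K (k + 1) → Density (F.P P.K) (k + 1) (SU N), LawsT k f → Laws (k + 1) (Rstep k f))
    {γ₁ : ℝ} (hγ : w.γ ≤ γ₁)
    (hUV9 : (genFlow M.βfun P.g0).InInterval γ₁ P.K → ∀ k, k ≤ P.K → Laws k (texpA P g k) → ∀ U : GaugeField (F.P P.K) k (SU N),
      M.χ P k U * Real.exp (-(1 / (genSeq M.βfun P.g0 k) ^ 2 * M.wilsonBG P k U)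
          - w.em (genSeq M.βfun P.g0 k) * (Fintype.card (Site (F.P P.K) k) : ℝ)) ≤ densityOfRepr F N ν Mx texpA P g k U ∧
      densityOfRepr F N ν Mx texpA P g k U ≤ Real.exp (w.ep (genSeq M.βfun P.g0 k) * (Fintype.card (Site (F.P P.K) k) : ℝ))) :
    Dag.B16_main (leavesP w P) :=
  b16_main_at_datumOfTower_repTower F N M τ w P (Rep := fun k => SeqOfRecord F ν Mx g P.K k → Density (F.P P.K) k (SU N))
    (texpA P g) Tstep Rstep Laws LawsT
    (fun (j : ℕ) (f : SeqOfRecord F ν Mx g P.K j → Density (F.P P.K) j (SU N)) (V : GaugeField (F.P P.K) j (SU N)) =>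
      ∑ s, chiSeqOfRecord F N ν Mx g P.K j s V * f s V)
    hC hsucc hρ hS9 hRpin hR9 hγ hUV9

/-- The same with (R₉) read ALONG the slot family (`LawsT k (Tstep k (texpA P g k)) → Laws (k+1) (texpA P g (k+1))`) — the form the 𝐑-leaf pinned along the run's
tower delivers by `Iff.rfl`. [cite: Balaban1989LargeFieldII, Thm 1 p.355, (0.1) pp.355–356, p.387, p.391] -/
theorem b16_main_at_datumOfTower_slots_along (hC : w.C = (datumOfTower F N M τ).C)
    (hρ : ∀ k, τ.ρ P k = densityOfRepr F N ν Mx texpA P g k)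
    (hS9 : ∀ k, k ≤ P.K → (M.Sect2Form P k ↔ (τ.ρ P k = densityOfRepr F N ν Mx texpA P g k ∧ Laws k (texpA P g k))))
    (hRpin : (∀ k, k < P.K → LawsT k (Tstep k (texpA P g k)) → Laws (k + 1) (texpA P g (k + 1))) → (w.up P).rOperation)
    (hRalong : ∀ k, k < P.K → LawsT k (Tstep k (texpA P g k)) → Laws (k + 1) (texpA P g (k + 1))) {γ₁ : ℝ} (hγ : w.γ ≤ γ₁)
    (hUV9 : (genFlow M.βfun P.g0).InInterval γ₁ P.K → ∀ k, k ≤ P.K → Laws k (texpA P g k) → ∀ U : GaugeField (F.P P.K) k (SU N),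
      M.χ P k U * Real.exp (-(1 / (genSeq M.βfun P.g0 k) ^ 2 * M.wilsonBG P k U)
          - w.em (genSeq M.βfun P.g0 k) * (Fintype.card (Site (F.P P.K) k) : ℝ)) ≤ densityOfRepr F N ν Mx texpA P g k U ∧
      densityOfRepr F N ν Mx texpA P g k U ≤ Real.exp (w.ep (genSeq M.βfun P.g0 k) * (Fintype.card (Site (F.P P.K) k) : ℝ))) :
    Dag.B16_main (leavesP w P) :=
  b16_main_at_datumOfTower_along F N M τ w P (Rep := fun k => SeqOfRecord F ν Mx g P.K k → Density (F.P P.K) k (SU N))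
    (texpA P g) Tstep Laws LawsT
    (fun (j : ℕ) (f : SeqOfRecord F ν Mx g P.K j → Density (F.P P.K) j (SU N)) (V : GaugeField (F.P P.K) j (SU N)) =>
      ∑ s, chiSeqOfRecord F N ν Mx g P.K j s V * f s V)
    hC hρ hS9 hRpin hRalong hγ hUV9

end Slots

/-! ## §3. The `S_N13 Rec₉` shape over tower data -/

section RecShape

variable {F N}

/-- **`S_N13`-shaped over tower data** (R420 (C) ∕ R422: «every stub is typed over the PINNED carriers of record, or with an explicit `Rec` parameter»): for ANY
class `Rec` of binding worlds each bound to the tower datum of SOME core and tower and supplying, at every run, representation data with the recursion, the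
Stage-₉ reading, the pin reading of its 𝐑-leaf and N13's two products (R₉), (UV₉) below its own `γ`, node N13 holds AT EVERY RUN OF EVERY `Rec`-WORLD.  At NODE 00's
Stage-9 record `Rec w := ∃ D, IsRecordOfRecord₉C F N D w` the core, tower, data and pin are the record's, and (R₉)∕(UV₉) are what a discharge proves there.
[cite: Balaban1989LargeFieldII, Thm 1 p.355, (0.1) pp.355–356, p.387, p.391; Balaban1988Convergent, p.244] -/
theorem b16_main_forall_towerDatum (Rec : WorldP → Prop)
    (h : ∀ w, Rec w → ∃ (M : RGMachineCore F (SU N)) (τ : M.Tower (avOfRecord F N)),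
      w.C = (datumOfTower F N M τ).C ∧ ∀ P : B12.RunParams,
        ∃ (Rep : ℕ → Type) (rep : (k : ℕ) → Rep k) (Tstep : (k : ℕ) → Rep k → Rep (k + 1))
          (Rstep : (k : ℕ) → Rep (k + 1) → Rep (k + 1)) (Laws : (k : ℕ) → Rep k → Prop) (LawsT : (k : ℕ) → Rep (k + 1) → Prop)
          (eval : (k : ℕ) → Rep k → Density (F.P P.K) k (SU N)),
        (∀ k, rep (k + 1) = Rstep k (Tstep k (rep k))) ∧
        (∀ k, τ.ρ P k = eval k (rep k)) ∧
        (∀ k, k ≤ P.K → (M.Sect2Form P k ↔ (τ.ρ P k = eval k (rep k) ∧ Laws k (rep k)))) ∧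
        ((∀ k, k < P.K → LawsT k (Tstep k (rep k)) → Laws (k + 1) (rep (k + 1))) → (w.up P).rOperation) ∧
        (∀ k, k < P.K → ∀ r : Rep (k + 1), LawsT k r → Laws (k + 1) (Rstep k r)) ∧
        ((genFlow M.βfun P.g0).InInterval w.γ P.K → ∀ k, k ≤ P.K → Laws k (rep k) → ∀ U : GaugeField (F.P P.K) k (SU N),
          M.χ P k U * Real.exp (-(1 / (genSeq M.βfun P.g0 k) ^ 2 * M.wilsonBG P k U)
              - w.em (genSeq M.βfun P.g0 k) * (Fintype.card (Site (F.P P.K) k) : ℝ)) ≤ eval k (rep k) U ∧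
          eval k (rep k) U ≤ Real.exp (w.ep (genSeq M.βfun P.g0 k) * (Fintype.card (Site (F.P P.K) k) : ℝ)))) :
    ∀ w, Rec w → ∀ P : B12.RunParams, Dag.B16_main (leavesP w P) := by
  intro w hw P
  obtain ⟨M, τ, hC, hP⟩ := h w hw
  obtain ⟨Rep, rep, Tstep, Rstep, Laws, LawsT, eval, hsucc, hρ, hS9, hRpin, hR9, hUV9⟩ := hP P
  exact b16_main_at_datumOfTower_repTower F N M τ w P rep Tstep Rstep Laws LawsT eval hC hsucc hρ hS9 hRpin hR9 le_rfl hUV9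

end RecShape

end Literature.MathematicalPhysics.QuantumFieldTheory.Balaban1983to89.B16NodeKnitTowerDatum

end
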